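import Summits.BirchSwinnertonDyer.BirchSwinnertonDyer.Theorems.ThetaPartnerAtTwoSignedMainConjectureCMTwoRankZeroLowerOffTwoRobustInvol
import Summits.BirchSwinnertonDyer.BirchSwinnertonDyer.Theorems.ThetaPartnerAtTwoSignedMainConjectureCMTwoRankZeroLowerOffTwoColemanOntoTwo
import Summits.BirchSwinnertonDyer.BirchSwinnertonDyer.Theorems.ThetaPartnerAtTwoSignedKatoUpToAtTwoPointsPackage
import Summits.BirchSwinnertonDyer.BirchSwinnertonDyer.Theorems.ThetaPartnerAtTwoSignedKatoUpToAtTwoLocalTwoColemanKernelConverse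
import Summits.BirchSwinnertonDyer.BirchSwinnertonDyer.Theorems.ThetaPartnerAtTwoSignedKatoUpToAtTwoFineStrictRat
import Literature.NumberTheory.EllipticCurves.BSDConductorProofs
import HarnessLib

/-!
# Route `ThetaPartnerAtTwo` (TP2), crux K2R0P♭ `SignedMainConjectureCMTwoRankZeroOfPubOfFlat` (stmt-BirchSwinnertonDyer-26471; derived
# node K2r0P stmt-BirchSwinnertonDyer-24945), line `rankzero` v16, stub (LDℓ)_A: **(LDℓ)_A from its `𝐇¹`-SIDE** — the LOWER twin of the K3
# lineage's transfer `SignedKatoOffTwo.localRobustPackageTwoInv_of_h1SideTwoInv` ((R2b) → (R2^ι)), on the SAME objects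

HONEST FRAMING (cell `pub/bsd-wall`, W-ALL row 1; width seat `bsd-wall-tp2-p2-w2` g3, `--supports` only). ONE THEOREM, an implication
between fully spelled statements (no definition, no named fact, no instance, no `sorry`); route-independent (no `Theses`/`Cruxes` import);
closes no item; the hypothesis carries ALL the research content; BSD is NOT proved by any of this.

## What is proved

`offTwoLower_of_h1SideLowerPackageTwo` — (LDℓ)_A (the registered stub's text, verbatim as a conclusion) from the LOWER `𝐇¹`-side
package (L2b): per CM class member `A` off the unit zone, cyclotomic datum, newform, `ϖ`, Pollack pair, fine dual datum `Y` and height-one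
`𝔭' ∌ 2`, at the place `v` of `ℚ` above `2`: SOME local lift `g` of the generator and SOME plus Honda system `d` at `v` ((L)(TR)(GEN)(GEN₀),
∃-supplied by HONDA⁺@2 = `Cruxes.SignedControlAtTwo.EulerChar.stub_plusHondaSystemTwo`, a tree theorem) carry
* a pinned `I = 𝐇¹_Γ(T₂A)` and an ADDITIVE `col₀ : 𝐇¹ → Hom(E(ℚ_{2,∞}·ℚ_v), ℤ₂)` with `col₀ (r • x) = lambdaSMul r (col₀ x)` — the `T₂A`-adic
  LOCAL TATE PAIRING along the tower (K3's (D-layer) definition item; `ColGlue.exists_col_linear` glues it from layer pairings);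
* (PT♭) the DEEP Poitou–Tate half in the points model: «every functional `z` on `E(ℚ_{2,∞}·ℚ_v)` whose Kummer values on the witnesses of the
  `⁺`-Selmer classes vanish agrees with `col₀ x`, up to the factor `2^m`, ON `E⁺_∞ = ⋃ₙ E⁺(ℚ_n·ℚ_v)` for some global `x ∈ 𝐇¹`»;
* (ERL♭ ⊇) «`L♭ ∣ Col♭(col₀ s)` at `𝔭'`» for a class `s ∈ 𝐇¹` (print: equality, Kato Thm. 12.5 / (15.12.2) + Prop. 15.9; K3 consumes ⊆);
* (g)^ι «`ℓ_{𝔭'}(𝐇¹/Λs) ≤ ℓ_{ι𝔭'}(X₀)`» (the EQUALITY half of Kato's IMC 12.10 for the CM form `f_A` off `(2)` — JLK 2011 Thm. 5.2 + Kato §15).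
Inside (all tree theorems): `P := Hom ⧸ Ker Col♭`, `ι_P := Col♭`, `q`, `j := j₀ ∘ res_{A⁺}` from `SignedKatoOffTwo.KummerPoint.exists_pointsPackage_two`
and `exists_pointsModelJ_two`; `col := q ∘ col₀`; clause (e) from `SignedLowerOffTwo.ColemanOnto.lengthAt_quotient_range_eq_zero_two`
(`Col♭` onto at `2`); clause (c) from `KummerPoint.toDual_pointsModelJ_eq_zero_of_resOfLe_eq_zero` + `FineStrictRat`; (b♭) from (PT♭) through
`ann(E⁺_∞) ⊆ Ker Col♭` (`SignedKatoOffTwo.ColemanConverse.mem_colemanKer_flat_of_forall_signedPlus_of_trace`); then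
`SignedLowerOffTwo.offTwoLower_of_lowerRobustPackageTwoInv`. So the CM lower port and K3's (R2b) now share EVERY local object and differ only in
the three displayed research clauses ((PT♭) vs K3's (Rec₀); (ERL♭ ⊇) vs (ERL♭ ⊆); (g)^ι vs Kato 13.4 (2)).

References: [Kobayashi2003] Thm. 6.2–6.3 (p. 11), (7.17)–(7.21), Thm. 7.3 (pp. 12–13), (8.23) (p. 18); [Kato2004Asterisque] Conj. 12.10 (p. 224),
Thm. 12.5 (p. 222), Prop. 15.9, (15.12.2), Lemma 15.13, (15.16.1) (pp. 258–265), §17.13 (p. 280); [Sprung2012] Def. 5.9, 7.1–7.2, Prop. 7.3, Def. 7.9;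
[JohnsonLeungKings2011] Thm. 5.2; [PollackRubin2004] Thm. 7.3.
-/

set_option autoImplicit false
-- the Theorems namespace of this sub repeats the summit name by design (D-0017 nested layout)
set_option linter.dupNamespace false

noncomputable section

open scoped Classical NumberField MatrixGroups ModularForm

open NumberField IsDedekindDomain CongruenceSubgroup

namespace Summit.BirchSwinnertonDyer.BirchSwinnertonDyer.Theorems

namespace SignedLowerOffTwo

open Literature.NumberTheory.EllipticCurves Literature.NumberTheory.GaloisRepresentations
  WeierstrassCurve ZpExtension Literature.NumberTheory.EllipticCurves.Kobayashi2003
  Literature.NumberTheory.EllipticCurves.Module Literature.NumberTheory.EllipticCurves.Kato2004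
  Literature.NumberTheory.EllipticCurves.GreenbergSelmer Literature.NumberTheory.EllipticCurves.Sprung2012
  Literature.NumberTheory.EllipticCurves.ModularForms Literature.NumberTheory.EllipticCurves.Rank1Residual
  Summit.BirchSwinnertonDyer.Rank1Residual.Supersingular

/-- **(LDℓ)_A from the LOWER `𝐇¹`-side package (L2b) at the place above `2`** — see the module docstring for the clause-by-clause reading.
Per datum: `g, hg, d` ((L)(TR)(GEN)(GEN₀)), `I`, `col₀` (additive, `Λ`-compatible for `lambdaSMul`), `s`, `m` with (PT♭) in the points model,
(ERL♭ ⊇) at `𝔭'` for every Coleman pair of `col₀ s`, and (g)^ι `ℓ_{𝔭'}(𝐇¹/Λs) ≤ ℓ_{ι𝔭'}(X₀)`. PUB-free; no Gross–Zagier–Kolyvagin, no injectivity,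
no finiteness. [cite: Kobayashi2003, Thm. 6.2–6.3 (p. 11), (7.17)–(7.21), Thm. 7.3 (pp. 12–13)] [cite: Kato2004Asterisque, Conj. 12.10 (p. 224),
Thm. 12.5 (p. 222), Lemma 15.13 and (15.16.1) (pp. 264–265), §17.13 (p. 280)] [cite: Sprung2012, Def. 5.9 (p. 1495), Prop. 7.3 (p. 1500), Def. 7.9 (p. 1503)] -/
theorem offTwoLower_of_h1SideLowerPackageTwo
    (h : ∀ (v : HeightOneSpectrum (𝓞 ℚ)), ((2 : ℕ) : 𝓞 ℚ) ∈ v.asIdeal →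
      ∀ (A : WeierstrassCurve ℚ) [A.IsElliptic] [A.IsGloballyMinimal],
        A.HasCM → A.analyticRank = 0 → GoodSS A 2 → A.frobeniusTrace 2 = 0 →
        2 ∣ A.shaOrder * A.tamagawaProduct →
        ∀ (κ : ZpExtension ℚ 2) (γ : Field.absoluteGaloisGroup ℚ),
          κ.IsCyclotomic → κ.IsTopGenerator γ → IsCyclotomicVariable 2 γ →
        ∀ [NeZero (A.conductorNorm ℤ)] (f : CuspForm (Gamma0 (A.conductorNorm ℤ)) 2),
          IsNewformOf A f → ∀ (ϖ : ℚ), (ϖ : ℝ) * A.realPeriodRat = plusPeriod f →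
        ∀ (Lplus Lminus : IwasawaAlgebra 2), IsPollackPair f 2 Lplus Lminus →
        ∀ [ContinuousSMul ℤ_[2] (A.tateModule 2)] (Y : A.FineSelmerDualData κ γ),
        ∀ 𝔭' : PrimeSpectrum (IwasawaAlgebra 2), 𝔭'.asIdeal.height = 1 →
          PowerSeries.C (2 : ℤ_[2]) ∉ 𝔭'.asIdeal →
        ∃ (g : Field.absoluteGaloisGroup (v.adicCompletion ℚ))
          (hg : κ.IsTopGenerator (resGalOfEmb (closureEmb (K := ℚ) (v.adicCompletion ℚ)) g))
          (d : ℕ → localPoints A (v.adicCompletion ℚ))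
          (I : Kato2004.IwasawaH1Data A 2 κ γ)
          (col₀ : I.H →+ (localTowerPointsOfEmb κ (closureEmb (K := ℚ) (v.adicCompletion ℚ)) A →+ ℤ_[2]))
          (s : I.H) (m : ℕ),
          (∀ n, d n ∈ localLayerPointsOfEmb κ (closureEmb (K := ℚ) (v.adicCompletion ℚ)) A n) ∧
          (∀ n, localTraceOfEmb κ (closureEmb (K := ℚ) (v.adicCompletion ℚ)) A (n + 1) (n + 2) (d (n + 2)) = -d n) ∧
          (∀ n : ℕ, 1 ≤ n → ∀ P ∈ localLayerPointsOfEmb κ (closureEmb (K := ℚ) (v.adicCompletion ℚ)) A n,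
            ∃ B ∈ AddSubgroup.closure (Set.range fun σ : Field.absoluteGaloisGroup (v.adicCompletion ℚ) ↦ σ • d n),
              ∃ P' ∈ localLayerPointsOfEmb κ (closureEmb (K := ℚ) (v.adicCompletion ℚ)) A (n - 1),
              ∃ R ∈ localLayerPointsOfEmb κ (closureEmb (K := ℚ) (v.adicCompletion ℚ)) A n, P = B + P' + 2 • R) ∧
          (∀ P ∈ localLayerPointsOfEmb κ (closureEmb (K := ℚ) (v.adicCompletion ℚ)) A 0,
            ∃ a : ℤ, ∃ R ∈ localLayerPointsOfEmb κ (closureEmb (K := ℚ) (v.adicCompletion ℚ)) A 0, P = a • d 0 + 2 • R) ∧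
          (∀ (r : IwasawaAlgebra 2) (x : I.H),
            col₀ (r • x) = lambdaSMul κ (closureEmb (K := ℚ) (v.adicCompletion ℚ)) A hg r (col₀ x)) ∧
          (∀ z : localTowerPointsOfEmb κ (closureEmb (K := ℚ) (v.adicCompletion ℚ)) A →+ ℤ_[2],
            (∀ (t : A.subgroupH1 2 κ.kerSubgroup), t ∈ signedSelmerInfty A κ 1 →
              ∀ (φ : contOneCocycles (discreteTopRep κ.kerSubgroup (A.geomPrimaryTorsion 2)))
                (Q : localPoints A (v.adicCompletion ℚ)) (k : ℕ), oneCocycleClass _ φ = t →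
              ∀ hQ : 2 ^ k • Q ∈ (⨆ n, signedLocalPoints κ (v.adicCompletion ℚ) A 1 n),
              (∀ τ : localSubgroupOfEmb κ.kerSubgroup (closureEmb (K := ℚ) (v.adicCompletion ℚ)),
                pointsMapOfEmb A (closureEmb (K := ℚ) (v.adicCompletion ℚ))
                    ((φ.1 (resGalSubgroupOfEmb κ.kerSubgroup _ τ) : A.geomPrimaryTorsion 2) : A.geomPoints) =
                  (τ : Field.absoluteGaloisGroup (v.adicCompletion ℚ)) • Q - Q) →
              (PadicInt.toZModPow k
                  (z ⟨2 ^ k • Q, SignedKatoOffTwo.KummerPoint.iSup_signedLocalPoints_le_localTowerPointsOfEmb A 2 κ 1 v hQ⟩)).val •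
                ((((2 : ℚ) ^ k)⁻¹ : ℚ) : AddCircle (1 : ℚ)) = 0) →
            ∃ x : I.H, ∀ (n : ℕ) (Q : localPoints A (v.adicCompletion ℚ))
              (hQ : Q ∈ signedLocalPointsOfEmb κ (closureEmb (K := ℚ) (v.adicCompletion ℚ)) A 1 n),
              (2 : ℤ_[2]) ^ m *
                  z ⟨Q, localLayerPointsOfEmb_le_localTowerPointsOfEmb κ _ A n (signedLocalPointsOfEmb_le κ _ A 1 n hQ)⟩ =
                col₀ x ⟨Q, localLayerPointsOfEmb_le_localTowerPointsOfEmb κ _ A n (signedLocalPointsOfEmb_le κ _ A 1 n hQ)⟩) ∧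
          (∀ Ls Lf : IwasawaAlgebra 2,
            IsColemanPair κ (closureEmb (K := ℚ) (v.adicCompletion ℚ)) A 0 g d (col₀ s) Ls Lf →
            lengthAt (IwasawaAlgebra 2) (IwasawaAlgebra 2 ⧸ Ideal.span {kobayashiL 1 Lplus Lminus}) 𝔭' ≤
              lengthAt (IwasawaAlgebra 2) (IwasawaAlgebra 2 ⧸ Ideal.span {Lf}) 𝔭') ∧
          lengthAt (IwasawaAlgebra 2) (I.H ⧸ Submodule.span (IwasawaAlgebra 2) {s}) 𝔭' ≤
            lengthAt (IwasawaAlgebra 2) Y.X (PrimeSpectrum.comap (IwasawaAlgebra.invol 2).toRingHom 𝔭')) :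
    ∀ (A : WeierstrassCurve ℚ) [A.IsElliptic] [A.IsGloballyMinimal],
      A.HasCM → A.analyticRank = 0 → GoodSS A 2 → A.frobeniusTrace 2 = 0 →
      2 ∣ A.shaOrder * A.tamagawaProduct →
      ∀ (κ : ZpExtension ℚ 2) (γ : Field.absoluteGaloisGroup ℚ),
        κ.IsCyclotomic → κ.IsTopGenerator γ → IsCyclotomicVariable 2 γ →
      ∀ [NeZero (A.conductorNorm ℤ)] (f : CuspForm (Gamma0 (A.conductorNorm ℤ)) 2),
        IsNewformOf A f → ∀ (ϖ : ℚ), (ϖ : ℝ) * A.realPeriodRat = plusPeriod f →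
      ∀ (Lplus Lminus : IwasawaAlgebra 2), IsPollackPair f 2 Lplus Lminus →
      ∀ (D : SignedSelmerDualData A κ γ 1), Module.IsTorsion (IwasawaAlgebra 2) D.X →
        ∀ 𝔭 : PrimeSpectrum (IwasawaAlgebra 2), 𝔭.asIdeal.height = 1 →
          PowerSeries.C (2 : ℤ_[2]) ∉ 𝔭.asIdeal →
          lengthAt (IwasawaAlgebra 2) (IwasawaAlgebra 2 ⧸ Ideal.span {kobayashiL 1 Lplus Lminus}) 𝔭 ≤
            lengthAt (IwasawaAlgebra 2) D.X 𝔭 := by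
  refine offTwoLower_of_lowerRobustPackageTwoInv
    fun A _ _ hcm hr hss ha hz κ γ hκ hγ hcv _ f hf ϖ hϖ Lplus Lminus hPP D _ hX Y k hk hkY 𝔭 h𝔭 hp𝔭 ↦ ?_
  -- the place of `ℚ` above `2`
  set v : HeightOneSpectrum (𝓞 ℚ) := (Rat.HeightOneSpectrum.primesEquiv (R := 𝓞 ℚ)).symm ⟨2, Nat.prime_two⟩ with hvdef
  have hv : ((2 : ℕ) : 𝓞 ℚ) ∈ v.asIdeal := (natCast_mem_asIdeal_iff_eq_primesEquiv_symm _ Nat.prime_two).mpr rfl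
  have hv2 : (2 : 𝓞 ℚ) ∈ v.asIdeal := by exact_mod_cast hv
  obtain ⟨g, hg, d, I, col₀, s, m, hd, htr, hgen, hgen0, hlin, hPT, hERL, hIMC⟩ :=
    h v hv A hcm hr hss ha hz κ γ hκ hγ hcv f hf ϖ hϖ Lplus Lminus hPP Y 𝔭 h𝔭 hp𝔭
  -- the points package: `P = Hom ⧸ Ker Col♭`, `ι_P = Col♭`, `q`, `j = j₀ ∘ res_{A⁺}`
  obtain ⟨j₀, hj⟩ := SignedKatoOffTwo.KummerPoint.exists_pointsModelJ_two A κ 1 hss v hv2 D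
  obtain ⟨P, _, _, ιP, q, j, hinj, hqsurj, hq, hpair, hval, hjq, hsemi, -⟩ :=
    SignedKatoOffTwo.KummerPoint.exists_pointsPackage_two A hss hκ hγ v hv2 hg hd htr hgen hgen0 D j₀ hj
  let incl := AddSubgroup.inclusion (SignedKatoOffTwo.KummerPoint.iSup_signedLocalPoints_le_localTowerPointsOfEmb A 2 κ 1 v)
  -- `col := q ∘ col₀`, `Λ`-linear by the intertwining clause
  let col : I.H →ₗ[IwasawaAlgebra 2] P :=
    { toFun := fun x ↦ q (col₀ x)
      map_add' := fun x y ↦ by rw [map_add, map_add]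
      map_smul' := fun r x ↦ by rw [RingHom.id_apply, hlin, hq] }
  have hcol : ∀ x, col x = q (col₀ x) := fun _ ↦ rfl
  -- `q` kills the functionals vanishing on `E⁺_∞` (`ann(E⁺_∞) ⊆ Ker Col♭`, then `ι_P` injective)
  have hqann : ∀ w : localTowerPointsOfEmb κ (closureEmb (K := ℚ) (v.adicCompletion ℚ)) A →+ ℤ_[2],
      (∀ (n : ℕ) (x : localPoints A (v.adicCompletion ℚ))
        (hx : x ∈ signedLocalPointsOfEmb κ (closureEmb (K := ℚ) (v.adicCompletion ℚ)) A 1 n),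
        w ⟨x, localLayerPointsOfEmb_le_localTowerPointsOfEmb κ _ A n (signedLocalPointsOfEmb_le κ _ A 1 n hx)⟩ = 0) →
      q w = 0 := by
    intro w hw
    have hwK := SignedKatoOffTwo.ColemanConverse.mem_colemanKer_flat_of_forall_signedPlus_of_trace hg hd htr hw
    rw [mem_colemanKer_iff] at hwK
    obtain ⟨Ls, Lf, hCP, hLf⟩ := hwK
    rw [Sprung2017.chromaticL_flat] at hLf
    apply hinj
    rw [hval w Ls Lf hCP, hLf, map_zero]
  refine ⟨I, P, inferInstance, inferInstance, ιP, col, j, s, m, hsemi, fun y hy ↦ ?_, fun y ↦ ?_,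
    ColemanOnto.lengthAt_quotient_range_eq_zero_two A κ v hss hv2 hg hd htr hgen0 ιP q hval 𝔭, ?_, hIMC⟩
  · -- (b♭) from (PT♭): `y = q z`, the Kummer values of `z` on `⁺`-Selmer witnesses vanish, so `2^m z ≡ col₀ x` on `E⁺_∞`
    obtain ⟨z, rfl⟩ := hqsurj y
    have hval0 : ∀ (t : A.subgroupH1 2 κ.kerSubgroup), t ∈ signedSelmerInfty A κ 1 →
        ∀ (φ : contOneCocycles (discreteTopRep κ.kerSubgroup (A.geomPrimaryTorsion 2)))
          (Q : localPoints A (v.adicCompletion ℚ)) (k : ℕ), oneCocycleClass _ φ = t →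
        ∀ hQ : 2 ^ k • Q ∈ (⨆ n, signedLocalPoints κ (v.adicCompletion ℚ) A 1 n),
        (∀ τ : localSubgroupOfEmb κ.kerSubgroup (closureEmb (K := ℚ) (v.adicCompletion ℚ)),
          pointsMapOfEmb A (closureEmb (K := ℚ) (v.adicCompletion ℚ))
              ((φ.1 (resGalSubgroupOfEmb κ.kerSubgroup _ τ) : A.geomPrimaryTorsion 2) : A.geomPoints) =
            (τ : Field.absoluteGaloisGroup (v.adicCompletion ℚ)) • Q - Q) →
        (PadicInt.toZModPow k
            (z ⟨2 ^ k • Q, SignedKatoOffTwo.KummerPoint.iSup_signedLocalPoints_le_localTowerPointsOfEmb A 2 κ 1 v hQ⟩)).val •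
          ((((2 : ℚ) ^ k)⁻¹ : ℚ) : AddCircle (1 : ℚ)) = 0 := by
      intro t ht φ Q k hφ hQ hτ
      have h1 := hj (z.comp incl) t ht φ Q k hφ hQ hτ
      rw [← hjq z, hy, map_zero, AddMonoidHom.zero_apply] at h1
      exact h1.symm
    obtain ⟨x, hx⟩ := hPT z hval0
    refine ⟨x, ?_⟩
    -- `C(2)^m • q z = q (2^m • z) = q (col₀ x) + q (2^m • z − col₀ x) = col x`
    have h2m : (PowerSeries.C (2 : ℤ_[2]) : IwasawaAlgebra 2) ^ m • q z = q (((2 : ℤ_[2]) ^ m) • z) := by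
      rw [← map_pow, ← hq, lambdaSMul_C]
    have hw : q (((2 : ℤ_[2]) ^ m) • z - col₀ x) = 0 := by
      refine hqann _ fun n Q hQ ↦ ?_
      rw [AddMonoidHom.sub_apply, AddMonoidHom.smul_apply, smul_eq_mul, hx n Q hQ, sub_self]
    rw [h2m, hcol, eq_comm, ← sub_eq_zero, ← map_sub, hw]
  · -- (c): `k (j y) = 0` — `j (q z) = j₀ (z|_{A⁺})` vanishes on the locally trivial classes, fine classes are locally trivial at `𝔭`
    obtain ⟨z, rfl⟩ := hqsurj y
    have h0 : k (j (q z)) = 0 := by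
      refine Y.bijective.1 (AddMonoidHom.ext fun s₀ ↦ ?_)
      rw [hkY, hjq, map_zero, AddMonoidHom.zero_apply]
      have hj' : ∀ (φA : ↥(⨆ n, signedLocalPoints κ (v.adicCompletion ℚ) A 1 n) →+ ℤ_[2])
          (s : A.subgroupH1 2 κ.kerSubgroup) (hs : s ∈ signedSelmerInfty A κ 1)
          (φ : contOneCocycles (discreteTopRep κ.kerSubgroup (A.geomPrimaryTorsion 2)))
          (Q : localPoints A (v.adicCompletion ℚ)) (k : ℕ)
          (_ : oneCocycleClass _ φ = s) (hQ : 2 ^ k • Q ∈ (⨆ n, signedLocalPoints κ (v.adicCompletion ℚ) A 1 n))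
          (_ : ∀ τ : localSubgroupOfEmb κ.kerSubgroup (closureEmb (K := ℚ) (v.adicCompletion ℚ)),
            pointsMapOfEmb A (closureEmb (K := ℚ) (v.adicCompletion ℚ))
                ((φ.1 (resGalSubgroupOfEmb κ.kerSubgroup _ τ) : A.geomPrimaryTorsion 2) : A.geomPoints) =
              (τ : Field.absoluteGaloisGroup (v.adicCompletion ℚ)) • Q - Q),
          D.toDual (j₀ φA) ⟨s, hs⟩ =
            (PadicInt.toZModPow k (φA ⟨2 ^ k • Q, hQ⟩)).val • (((((2 : ℕ) : ℚ) ^ k)⁻¹ : ℚ) : AddCircle (1 : ℚ)) := by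
        intro φA s hs φ Q k hφ hQ hτ
        rw [hj φA s hs φ Q k hφ hQ hτ, Nat.cast_ofNat]
      exact SignedKatoOffTwo.KummerPoint.toDual_pointsModelJ_eq_zero_of_resOfLe_eq_zero A 2 κ 1 v D j₀ hj' _ _
        (SignedKatoOffTwo.FineStrictRat.resOfLe_eq_zero_of_mem_fineSelmerInfty_rat A κ hκ v hv s₀.2)
    rw [h0, smul_zero]
  · -- (f) at the unique ♭-Coleman value of `col₀ s`
    obtain ⟨Ls, hLs⟩ := hpair (col₀ s)
    exact hERL Ls _ hLs

end SignedLowerOffTwo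

end Summit.BirchSwinnertonDyer.BirchSwinnertonDyer.Theorems

end
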